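import Literature.NumberTheory.LFunctions.YoshidaWindowSpaces
import HarnessLib

/-!
# Format C — the SECTOR SPLIT: even/odd real PSD certificates give Hermitian positivity on `modes N`

Helper file of the rh-explicit Weil-positivity programme (`--supports stmt-RiemannHypothesis-0098`; seat
rh-explicit-weil-2), RH-free, no definitions, no named facts.  Pure finite-sum algebra.

For a real kernel `G : ℤ → ℤ → ℝ` with the reflection symmetry `G(−n,−m) = G(n,m)` (the Weil window form on
Yoshida's basis has it: `Literature/…/YoshidaWindowGram.lean`, and the form is real on real functions) we prove

* `sum_modes_mul_mul_eq_sectors`: for REAL `x` on `modes N = {−N,…,N}`,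
  `Σ_{n,m} x_n x_m G(n,m) = Σ_{n,m ≤ N} y_n y_m M⁺(n,m) + Σ_{k,l < N} z_k z_l M⁻(k,l)`,
  `y₀ = x₀`, `y_n = x_n + x_{−n}`, `z_k = x_{k+1} − x_{−(k+1)}`, with the EVEN sector matrix
  `M⁺(0,m) = G(0,m)`, `M⁺(n,0) = G(n,0)`, `M⁺(n,m) = (G(n,m) + G(n,−m))/2` (`n,m ≥ 1`) and the ODD one
  `M⁻(k,l) = (G(k+1,l+1) − G(k+1,−(l+1)))/2`;
* `sum_modes_re_conj_mul_nonneg_of_sectors`: if `M⁺` and `M⁻` are positive semidefinite real quadratic forms then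
  `0 ≤ Σ_{n,m ∈ modes N} Re(conj c_n · c_m) G(n,m)` for every `c : ℤ → ℂ` (`Re(conj c_n c_m) = Re c_n Re c_m + Im c_n Im c_m`).

This is Yoshida's "we may assume `φ` is odd or even" (§6 p. 302; sectors `(χ_n ± χ_{−n})/√2` of (6.10), whose matrices
are the congruent `DM⁺D`, `D = diag(1,√2,…)`, and `2M⁻` — the same positivity) in the matrix form that the format-C
pipeline uses: two REAL PSD certificates per `N` (weil-2 `PsdDyadic.checkPsdMid`) ⇒ the Hermitian hypothesis of
weil-3's dictionary via the entry theorem `weilWindowForm_sum_smul_chi` (`WeilFormatCEntry.lean`).  cc-s2-4's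
`SectorSplitTwo` is the instance `G = gram b` (their `gramEven = DM⁺D`, `gramOdd = 2M⁻` re-indexed by `k ↦ k+1`).

References: H. Yoshida, Adv. Stud. Pure Math. 21 (1992) 281–325, §2, §6 (6.2)/(6.10) [Yoshida1992HermitianForms].
-/

set_option linter.dupNamespace false

noncomputable section

open Complex Finset
open scoped Real ComplexConjugate BigOperators

namespace Summit.RiemannHypothesis.RiemannHypothesis.Theorems.WeilFormatC

open Literature.NumberTheory.LFunctions Literature.NumberTheory.LFunctions.Yoshida1992

/-! ## Splitting sums over `modes N = {−N, …, N}` into the zero mode and the pairs `±(k+1)` -/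

/-- `modes (N+1) = {N+1, −(N+1)} ∪ modes N`. -/
theorem modes_succ (N : ℕ) :
    modes (N + 1) = insert ((N : ℤ) + 1) (insert (-((N : ℤ) + 1)) (modes N)) := by
  ext k
  simp only [mem_modes, Finset.mem_insert, abs_le]
  push_cast
  omega

/-- `Σ_{n ∈ modes N} f(n) = f(0) + Σ_{k<N} (f(k+1) + f(−(k+1)))`. -/
theorem sum_modes_eq (f : ℤ → ℝ) (N : ℕ) :
    ∑ n ∈ modes N, f n = f 0 + ∑ k ∈ Finset.range N, (f ((k : ℤ) + 1) + f (-((k : ℤ) + 1))) := by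
  induction N with
  | zero => simp [modes]
  | succ N ih =>
    rw [modes_succ, Finset.sum_insert, Finset.sum_insert, ih, Finset.sum_range_succ]
    · ring
    · simp only [mem_modes, abs_le]; omega
    · simp only [Finset.mem_insert, mem_modes, abs_le]; omega

/-! ## The sector split of a reflection-symmetric real quadratic form -/

variable (G : ℤ → ℤ → ℝ)

/-- **Sector decomposition.**  Let `G : ℤ → ℤ → ℝ` satisfy `G(−n,−m) = G(n,m)`.  For a REAL vector `x` on `modes N`
put `y₀ = x₀`, `y_{k+1} = x_{k+1} + x_{−(k+1)}`, `z_k = x_{k+1} − x_{−(k+1)}`.  Then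
`Σ_{n,m ∈ modes N} x_n x_m G(n,m) = Σ_{n,m ≤ N} y_n y_m M⁺(n,m) + Σ_{n,m < N} z_n z_m M⁻(n,m)` with the EVEN sector
matrix `M⁺(0,0) = G(0,0)`, `M⁺(0,m) = G(0,m)`, `M⁺(n,0) = G(n,0)`, `M⁺(n,m) = (G(n,m) + G(n,−m))/2` (`n,m ≥ 1`) and
the ODD one `M⁻(k,l) = (G(k+1,l+1) − G(k+1,−(l+1)))/2`.  (Yoshida's (6.10) uses the orthonormal
`(χ_n ± χ_{−n})/√2`, i.e. the congruent matrices `DM⁺D`, `D = diag(1,√2,…)`, and `2M⁻`; positivity is the same.) -/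
theorem sum_modes_mul_mul_eq_sectors (hrefl : ∀ n m, G (-n) (-m) = G n m) (N : ℕ) (x : ℤ → ℝ) :
    ∑ n ∈ modes N, ∑ m ∈ modes N, x n * x m * G n m =
      (∑ n ∈ Finset.range (N + 1), ∑ m ∈ Finset.range (N + 1),
        (if n = 0 then x 0 else x n + x (-(n : ℤ))) * (if m = 0 then x 0 else x m + x (-(m : ℤ))) *
          (if n = 0 then G 0 m else if m = 0 then G n 0 else (G n m + G n (-(m : ℤ))) / 2)) +
      ∑ k ∈ Finset.range N, ∑ l ∈ Finset.range N,
        (x ((k : ℤ) + 1) - x (-((k : ℤ) + 1))) * (x ((l : ℤ) + 1) - x (-((l : ℤ) + 1))) *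
          ((G ((k : ℤ) + 1) ((l : ℤ) + 1) - G ((k : ℤ) + 1) (-((l : ℤ) + 1))) / 2) := by
  have h0m : ∀ m : ℤ, G 0 (-m) = G 0 m := fun m ↦ by simpa using hrefl 0 m
  have hn0 : ∀ n : ℤ, G (-n) 0 = G n 0 := fun n ↦ by simpa using hrefl n 0
  have hnm : ∀ n m : ℤ, G (-n) m = G n (-m) := fun n m ↦ by simpa using hrefl n (-m)
  -- split all four `modes`/`range (N+1)` sums into zero mode + pairs
  rw [sum_modes_eq, Finset.sum_range_succ']
  simp_rw [sum_modes_eq (fun m ↦ x _ * x m * G _ m), Finset.sum_range_succ' (fun m ↦ _ * _ * _)]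
  simp only [if_true, Nat.cast_zero, neg_zero, Nat.cast_succ, Nat.succ_ne_zero, if_false, h0m, hn0, hrefl]
  simp_rw [hnm]
  -- everything is now indexed by `range N`; distribute and compare
  simp only [add_mul, mul_add, sub_mul, mul_sub, Finset.sum_add_distrib, Finset.sum_sub_distrib, add_div, sub_div]
  simp only [← mul_div_assoc, ← Finset.sum_div]
  ring
/-- **Sector split ⇒ Hermitian positivity.**  If `G : ℤ → ℤ → ℝ` satisfies `G(−n,−m) = G(n,m)` and its even and
odd sector matrices `M⁺` (on `{0,…,N}`) and `M⁻` (on `{0,…,N−1}`, standing for the modes `1,…,N`) of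
`sum_modes_mul_mul_eq_sectors` are positive semidefinite as REAL quadratic forms, then the Hermitian form
`Σ_{n,m ∈ modes N} Re(conj c_n · c_m) G(n,m)` is nonnegative for every complex `c` — the reduction of Yoshida §2/§6
("we may assume `φ` is odd or even", p. 302) in matrix form; with L-C1 (`weilWindowForm_sum_smul_chi`) and weil-3's
dictionary this turns two real PSD certificates per `N` into `0 ≤ weilWindowForm a (Σ_{|n|≤N} c_nχ_n)`. -/
theorem sum_modes_re_conj_mul_nonneg_of_sectors (hrefl : ∀ n m, G (-n) (-m) = G n m) (N : ℕ)
    (heven : ∀ y : ℕ → ℝ, 0 ≤ ∑ n ∈ Finset.range (N + 1), ∑ m ∈ Finset.range (N + 1),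
      y n * y m * (if n = 0 then G 0 m else if m = 0 then G n 0 else (G n m + G n (-(m : ℤ))) / 2))
    (hodd : ∀ z : ℕ → ℝ, 0 ≤ ∑ k ∈ Finset.range N, ∑ l ∈ Finset.range N,
      z k * z l * ((G ((k : ℤ) + 1) ((l : ℤ) + 1) - G ((k : ℤ) + 1) (-((l : ℤ) + 1))) / 2))
    (c : ℤ → ℂ) :
    0 ≤ ∑ n ∈ modes N, ∑ m ∈ modes N, (conj (c n) * c m).re * G n m := by
  have hq : ∀ x : ℤ → ℝ, 0 ≤ ∑ n ∈ modes N, ∑ m ∈ modes N, x n * x m * G n m := by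
    intro x
    rw [sum_modes_mul_mul_eq_sectors G hrefl N x]
    exact add_nonneg (heven fun n ↦ if n = 0 then x 0 else x n + x (-(n : ℤ)))
      (hodd fun k ↦ x ((k : ℤ) + 1) - x (-((k : ℤ) + 1)))
  have hsplit : ∑ n ∈ modes N, ∑ m ∈ modes N, (conj (c n) * c m).re * G n m =
      (∑ n ∈ modes N, ∑ m ∈ modes N, (c n).re * (c m).re * G n m) +
        ∑ n ∈ modes N, ∑ m ∈ modes N, (c n).im * (c m).im * G n m := by
    rw [← Finset.sum_add_distrib]
    refine Finset.sum_congr rfl fun n _ ↦ ?_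
    rw [← Finset.sum_add_distrib]
    refine Finset.sum_congr rfl fun m _ ↦ ?_
    simp only [Complex.mul_re, Complex.conj_re, Complex.conj_im]
    ring
  rw [hsplit]
  exact add_nonneg (hq fun n ↦ (c n).re) (hq fun n ↦ (c n).im)

end Summit.RiemannHypothesis.RiemannHypothesis.Theorems.WeilFormatC
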